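import Summits.ResolutionOfSingularities.ResolutionOfSingularities.Theorems.WeightedInvariantIota3ResidueOfLemmaC
import Summits.ResolutionOfSingularities.ResolutionOfSingularities.Theorems.WeightedInvariantIota3LemmaCFunctional
import HarnessLib

/-!
# GAP LIST OF RECORD for `stub_keyRungGrHomLE_three`: hD, hgame, LEMMA C′ (the functional-equation form)
# (door `HypersurfaceCentreConstruction`, stmt-ResolutionOfSingularities-19897)

Helper for `stub_keyRungGrHomLE_three` (def-free, `--supports 19897`).  `keyRungGrHomLE_three_of_lemmaC` (…Iota3ResidueOfLemmaC) with its
hypothesis LEMMA C discharged down to LEMMA C′ by `LemmaC.lemmaC_of_functional` (…Iota3LemmaCFunctional: the case `β̄ = 0` is proved, the case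
`β̄ ≠ 0` is the functional equation).  LEMMA C′, for a field `κ` and `0 < r₂ < r₁`, `1 ≤ j`, `1 ≤ ν`: «a pure `Φ ∈ κ[X₁,X₂]` (monomials `X₁^{e₁}X₂^{e₂}`,
`r₁e₂ + r₂e₁ = r₁ν`) with `X₂^ν ∈ supp Φ`, fixed by the substitution `X₁ ↦ X₁ + εX₀^j`, `X₂ ↦ X₂ + τ` (`ε ≠ 0`, `τ` free of `X₂`), is
`u(X₂ − aX₁^{r₁/r₂})^ν` with `a ≠ 0` only if `r₂ ∣ r₁`».  Proof plan (paper-complete): memo RESIDUE-PLAN.md §3b (root-curve / valuation argument for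
`r₂ ∣ r₁`; weighted homogeneity + factor permutation for `r₂ ∤ r₁`).  [OURS · L1 W4.3 · audit glue; AI work, weaker than expert review; nothing here is
a statement of the manuscript under review.]
-/

noncomputable section

open IsLocalRing Literature.AlgebraicGeometry.Resolution MvPolynomial
open Summit.ResolutionOfSingularities.ResolutionOfSingularities.Theorems

set_option linter.dupNamespace false -- mandated namespace of this single-conjunct summit

namespace Summit.ResolutionOfSingularities.ResolutionOfSingularities.Cruxes.HypersurfaceCentreConstruction.LocalEngine

open Iota3 in
/-- **GAP LIST OF RECORD for `stub_keyRungGrHomLE_three` — hD, hgame, LEMMA C′.**  `KeyRungGrHomLE 3 p` from hD (desc-τ as typed; door-proved),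
hgame, and LEMMA C′ (the functional-equation form of the dominance residue; pure algebra over a field).
(`keyRungGrHomLE_three_of_lemmaC` ∘ `LemmaC.lemmaC_of_functional`.) [OURS · L1 W4.3 · audit glue] -/
theorem keyRungGrHomLE_three_of_lemmaC' (p : ℕ)
    (hD : ∀ (T T' : Type) [CommRing T] [IsRegularLocalRing T] [CommRing T'] [IsRegularLocalRing T'] [Algebra T T']
      [IsLocalHom (algebraMap T T')] [Algebra.FormallySmooth T T'] [Algebra.EssFiniteType T T'] (g : T),
      ringKrullDim T' ≤ 3 → IsTiePosition T' (algebraMap T T' g) → IsTiePosition T g)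
    (hgame : CanonicalGameClauseHomLE 3 p iotaFlatT jFlatT)
    (hC' : ∀ (κ : Type) [Field κ] (r₁ r₂ j ν : ℕ), 0 < r₂ → r₂ < r₁ → 1 ≤ j → 1 ≤ ν →
      ∀ (Φ : MvPolynomial (Fin 3) κ) (ε : κ) (τ : MvPolynomial (Fin 3) κ),
      (∀ e ∈ Φ.support, e 0 = 0 ∧ r₁ * e 2 + r₂ * e 1 = r₁ * ν) → Φ.coeff (Finsupp.single 2 ν) ≠ 0 → ε ≠ 0 →
      (∀ e ∈ τ.support, e 2 = 0) → Φ = aeval ![X 0, X 1 + C ε * X 0 ^ j, X 2 + τ] Φ →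
      ∃ u a : κ, Φ = C u * (X 2 - C a * X 1 ^ (r₁ / r₂)) ^ ν ∧ (a ≠ 0 → r₂ ∣ r₁)) :
    KeyRungGrHomLE 3 p :=
  keyRungGrHomLE_three_of_lemmaC p hD hgame
    (fun κ _ r₁ r₂ j ν hr₂ hr hj hν Φ η ζ s θ hΦ hΦν hηhom hη0 hζhom hs hΦeq =>
      LemmaC.lemmaC_of_functional hr₂ hr hj hν (hC' κ r₁ r₂ j ν hr₂ hr hj hν) Φ η ζ s θ hΦ hΦν hηhom hη0 hζhom hs hΦeq)

end Summit.ResolutionOfSingularities.ResolutionOfSingularities.Cruxes.HypersurfaceCentreConstruction.LocalEngine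

end
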